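import Literature.AlgebraicGeometry.Hyperkaehler.GeneralizedKummerMonodromy
import Literature.AlgebraicGeometry.Hyperkaehler.K3HilbertSquareTypeCohomology
import HarnessLib

/-!
# Beauville–Bogomolov markings EXIST on projective varieties of `Kumⁿ`-type and of `K3^[n]`-type, with their Hodge clauses (Beauville 1983; Huybrechts 1999; Rapagnetta 2008; O'Grady 2021 §2.2) — NAMED FACTS + kernel

[topic AlgebraicGeometry/Hyperkaehler]

Layer `Literature/AlgebraicGeometry/Hyperkaehler`; cross-ladder literature-typing layer (D-0088(4), tranche
LT-H4, seat `hodge-lit-oqh-1` gen 5).  The tree DEFINES Beauville–Bogomolov markings of the two classical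
deformation types — `IsMarkedKum n Y φ P` (file `GeneralizedKummerMonodromy`: `H²(Y,ℤ) ≅ U³ ⊕ ⟨−2(n+1)⟩`
integrally, Fujiki relation `a^{2n} = (n+1)(2n−1)!!·q(φa)ⁿ·P`) and `IsMarkedK3Hilb n X φ P` (file
`K3HilbertTypeMonodromy`: `Λ_{K3} ⊕ ⟨2−2n⟩`, constant `(2n−1)!!`) — and quantifies OVER markings in five
records (`Markman2023_monodromyGroupH2_kummerType`, `Markman2010_monodromyGroupH2_K3HilbertType`,
`OGrady2008_dualBBFClass_algebraic`, `Markman2024_rationalHodgeIsometry(_lift)_algebraic_marked`) and in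
the `MarkedK3Sq[X, φ, P, z]` binders of the routes `NikulinTwinTransport` / `MarkmanPartnerTransport`, but
nowhere records that a marking EXISTS (`lean search`: no `∃ … IsMarkedKum`, no `∃ … IsMarkedK3Hilb`).  This
file types the two EXISTENCE statements as printed — the Beauville–Bogomolov lattice and the Fujiki constant
of the two deformation types (Rapagnetta's table; Beauville Props. 6, 8, §9; O'Grady §2.2), which are
deformation resp. topological invariants (Rapagnetta Thm. 3.0.9 = Beauville Thm. 5 + Fujiki), TOGETHER WITH
the Hodge clauses of the period point (Beauville Thm. 5 (b); Huybrechts 1.9: `q(σ) = 0`, `q(σ+σ̄) > 0`,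
`H^{1,1} ⊥ H^{2,0} ⊕ H^{0,2}`) in the verbatim shape of the routes' `MarkedK3Sq` clauses (m4)–(m6) — and
PROVES the by-name consequences: `b₂ = 7` / `b₂ = 23`; O'Grady's dual class `q_X^∨` algebraic on EVERY
projective `K3^{[2]}`-type fourfold (marking-free); Markman's `Mon² = 𝒲^{det·χ}` realised on every
projective `Kumⁿ`-type variety; the literal `MarkedK3Sq`-shaped existence for `K3^{[2]}`-type.
HONEST FRAMING: typed ≠ proved ≠ endorsed; nothing here bears on HC / HC_AV / W₆ / HC_Kum4Type.

## Sources (read at source; locators = files of the materialised texts)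

* [Rapagnetta2007] A. Rapagnetta, *On the Beauville form of the known irreducible symplectic varieties*,
  Math. Ann. 340 (2008) 77–95 = arXiv:math/0606409 — **REFEREED**; held `paper:arxiv-math_0606409`.
  Introduction [p0003:L21–L31]: "For any irreducible symplectic variety `Y`, the group `H²(Y,ℤ)` is
  endowed with a deformation invariant integral primitive bilinear form `B_Y`, called the Beauville form.
  Related with the Beauville form there is a positive rational constant `c_Y`, called the Fujiki constant,
  which is a topological invariant of `Y`. […] in the cases of the Beauville examples they have been known
  since the paper [Be83]"; TABLE [p0003:L41–L57]: "`X^{[n]}`: `dim 2n`, `b₂ = 23`, `c_Y = (2n)!/(n!2ⁿ)`,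
  `(H²(Y,ℤ), B_Y) = H^{⊕3} ⊕ (−E₈)^{⊕2} ⊕ (−2(n−1))`"; "`Kⁿ(T)`: `dim 2n`, `b₂ = 7`,
  `c_Y = (2n)!/(n!2ⁿ)·(n+1)`, `(H²(Y,ℤ), B_Y) = H^{⊕3} ⊕ (−2(n+1))`" (`H` the hyperbolic plane; the held
  arXiv text prints the exponent of `−E₈` as `3`, a misprint for `2`: `b₂ = 23 = 6 + 16 + 1`); **Thm.
  3.0.9** (Beauville–Fujiki) [p0010:L9–L22]: "Let `Y` be irreducible symplectic variety of dimension `2n`.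
  There exist a unique indivisible bilinear integral symmetric form `B_Y ∈ S²(H²(Y,ℤ))^*`, called the
  Beauville form, and a unique positive constant `c_Y ∈ ℚ`, called the Fujiki constant, such that for any
  `α ∈ H²(Y,ℂ)`  `∫_Y α^{2n} = c_Y B_Y(α,α)ⁿ`  and for `0 ≠ ω ∈ H⁰(Ω²_Y)`  `B_Y(ω + ω̄, ω + ω̄) > 0`."
* [Beauville1983] A. Beauville, J. Differential Geom. 18 (1983) 755–782 — **REFEREED**; held
  `paper:doi-10-4310-jdg-1214438181`.  §6 **Prop. 6** + Remarque [p0014:L23–L37]: "`S^{[r]}` est simplement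
  connexe, il existe un homomorphisme injectif `i : H²(S,ℂ) → H²(S^{[r]},ℂ)`, compatible aux structures de
  Hodge, et on a `H²(S^{[r]},ℂ) = i(H²(S,ℂ)) ⊕ ℂ[E]`", "`H²(S^{[r]},ℤ) = i(H²(S,ℤ)) ⊕ ℤδ`, où `2δ = [E]`";
  §7 **Prop. 8** [p0015:L42–L45]: "`K_r` est simplement connexe; il existe un homomorphisme injectif
  `j : H²(A,ℂ) → H²(K_r,ℂ)`, compatible aux structures de Hodge, et pour `r ≥ 2` on a
  `H²(K_r,ℂ) = j(H²(A,ℂ)) ⊕ ℂ[F]`"; §8 **Thm. 5** [p0018:L35–L41]: "(a) La forme quadratique `q` est non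
  dégénérée; à un scalaire réel positif près, elle provient d'une forme quadratique entière sur `H²(X,ℤ)`,
  de signature `(3, b − 3)`. (b) Soit `Ω ⊂ ℙ(H²(X,ℂ))` définie par `q(α) = 0`, `q(α + ᾱ) > 0`. On a
  `p(𝔐) ⊂ Ω`, et l'application des périodes est un isomorphisme local"; §9 **Lemme 1** [p0023:L22–L25]
  and **Remarque 1** [p0024:L16–L19]: "`q` induit sur `H²(S,ℂ)`, à un facteur positif près, la forme
  quadratique associée au cup-produit […] la classe `e` du diviseur exceptionnel est orthogonale pour `q` à
  l'image de `i`", "Normalisons `q` de façon que `q(i(α)) = α²`; on peut alors montrer qu'on a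
  `q(e) = −8(r − 1)`" (`e = 2δ`, so `q(δ) = −2(r−1)`).
* [Huybrechts1999] D. Huybrechts, *Compact hyperkähler manifolds: basic results*, Invent. Math. 135 (1999)
  63–113 = alg-geom/9705025 — **REFEREED**; held `paper:arxiv-alg-geom_9705025`.  §1.9
  [p0004:L120–p0005:L8]: Beauville's form `f`; "with respect to this quadratic form `H^{1,1}(X)` is
  orthogonal to `H^{2,0}(X) ⊕ H^{0,2}(X)`. Moreover, `f(σ) = 0` and `f(σ + σ̄) = 1 > 0`"; [p0005:L33–L38]:
  "There exists a positive constant `c ∈ ℝ` such that `q_X := c·f` is a primitive integral quadratic form on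
  `H²(X,ℤ)` of index `(3, b₂(X) − 3)` […] `q_X(σ) = 0` and `q_X(σ + σ̄) > 0`"; §1.11 [p0005:L80–L88]: "Fujiki
  shows […] `v(β) = ∫β^{2n} = c q_X(β)ⁿ` and in this case one has `c > 0`."
* [OGrady2021KummerTori] K. O'Grady, IMRN 2021 — **REFEREED**; held `paper:arxiv-1805.12075`, §2.2
  [p0005:L121–L145]: "`H²(K_n(A);ℤ) = μ₂(H²(A;ℤ)) ⊕ ℤξ_n` […] `(μ₂(α) + xξ_n, μ₂(β) + yξ_n) = (∫_A α∧β) −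
  2(n+1)xy` […] the normalized Fujiki constant of `K_n(A)` equals `n+1`, i.e.
  `∫_{K_n(A)} α^{2n} = (n+1)(2n−1)!!(α,α)ⁿ  ∀α ∈ H²(K_n(A);ℂ)`."
* [Markman2023GeneralizedKummers] §1.1 p. 234 (signature `(3,4)`, residual group cyclic of order `dim Y + 2`)
  and [Markman2024] §1.3 Step 1 (`Λ = Λ_{K3} ⊕ ℤδ`, `(δ,δ) = 2 − 2n`) — as quoted in the two marking files.
* [HatcherAT2002] Thm. 3.26 (fundamental class of a closed connected oriented manifold generates `H_{top}`;
  the integral top cohomology of the compact Kähler `2n`-fold is `ℤ·P`, clause (k1)).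

## Rendering (tree carriers) and faithfulness

For `Y` smooth projective of dimension `2n ≥ 4` and of `Kumⁿ`-type (`IsOfGeneralizedKummerType n Y`; resp.
`X` of `K3^[n]`-type, `IsOfK3HilbertType n X`):
* "`(H²(Y,ℤ), B_Y) ≅ U³ ⊕ ⟨−2(n+1)⟩`" (resp. `Λ_{K3} ⊕ ⟨2−2n⟩`), "`∫α^{2n} = c_Y B_Y(α,α)ⁿ`,
  `c_Y = (2n)!/(n!2ⁿ)·(n+1)`" (resp. `(2n)!/(n!2ⁿ)`; `(2n)!/(n!2ⁿ) = (2n−1)!!`) ↦ `∃ φ P, IsMarkedKum n Y φ P`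
  (resp. `IsMarkedK3Hilb n X φ P`): `φ : H²(Y(ℂ); ℂ) ≅ Λ ⊗ ℂ` carrying the integral classes onto `ℤ^{b₂}`
  (the integral isometry; torsion is invisible in `ℂ`-cohomology), `P` the integral generator of
  `H^{4n}(Y(ℂ); ℂ)` (the class with `⟨P,[Y]⟩ = 1`, Hatcher 3.26), and the Fujiki relation in the ring
  `H^•(Y(ℂ); ℂ)` with the tree's constants `kumFujikiConstant n = (n+1)(2n−1)!!` / `(2n−1)!!` — VERBATIM the
  printed constants.  Print states the lattice and the constant for the Beauville MODELS `Kⁿ(T)`, `S^{[n]}`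
  and that `B_Y` is a deformation invariant and `c_Y` a topological invariant (Rapagnetta p0003:L21–L26;
  Thm. 3.0.9 uniqueness), whence for every member of the deformation type; FAITHFUL.
* Hodge clauses of the period point `z := φ(σ)` (`σ` a generator of `H^{2,0}`, `h^{2,0} = 1` for an
  irreducible symplectic manifold — Beauville Props. 6/8 "`H^{2,0}(S^{[r]}) = H^{2,0}(S)` de dimension 1"):
  (m4) `φ⁻¹z` is of type `(2,0)` and spans the `(2,0)`-classes; (m5) the `(1,1)`-classes are exactly the
  classes `q`-orthogonal to `z` and `z̄` (Huybrechts 1.9 "`H^{1,1}` is orthogonal to `H^{2,0} ⊕ H^{0,2}`",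
  with equality by dimension count since `q` is non-degenerate on `⟨σ, σ̄⟩` — `q(σ) = 0`, `q(σ,σ̄) > 0`);
  (m6) `q(z,z) = 0`, `Re q(z̄,z) > 0` (Beauville Thm. 5 (b); Rapagnetta Thm. 3.0.9: `B(ω+ω̄,ω+ω̄) =
  2B(ω,ω̄) > 0`; `z̄ = star z` componentwise since `φ` is defined over `ℤ`).  Spelled with
  `HodgeTheory.IsOfHodgeType (2n) Y 2 p q` exactly as clauses (m4)–(m6) of `MarkedK3Sq` in
  `Summits/…/NikulinTwinTransport*` / `Theses/MarkmanPartnerTransport` (there for `n = 2`).  FAITHFUL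
  (REFEREED; (m5)'s "exactly" is the one-line dimension count above — PRINT-SYNTHESIS in that clause only).
* NOT typed: non-projective members (the tree's deformation-type predicates are used with
  `IsSmoothProjective` throughout; TODO line); uniqueness of `(B_Y, c_Y)`; the signature `(3, b₂−3)` as a
  clause (it is a property of the fixed Gram matrices `kumGram n` / `k3HilbertGram n`); OG6 / OG10 rows of
  the table (`OGradySixType` has no marking predicate); Beauville's `δ` with `2δ = [E]`.

## Kernel (PROVED here)

`finrank_complexBetti_two_eq` (`b₂(Y) = 7`, `b₂(X) = 23` from a marking — Beauville Props. 6, 8);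
`OGrady2008_dualBBFClass_algebraic.exists_marking` (for EVERY smooth projective `K3^{[2]}`-type fourfold
there is a marking `φ` with `dualBBFClass 2 φ = ±q_X^∨` ALGEBRAIC and `(2/5)q^∨` integral — the marked record
made unconditional in its marking); `Markman2023_monodromyGroupH2_kummerType.exists_marking` (Markman's
`Mon²(Y) = 𝒲^{det·χ}` realised through SOME marking of every projective `Kumⁿ`-type `Y`);
`Rapagnetta2008_exists_isMarkedK3Hilb.exists_markedK3Sq` (the `n = 2` statement in the literal
`MarkedK3Sq[X, φ, P, z]` spelling of the routes: `a⁴ = 3·q(φa)²·P`, `IsOfHodgeType 4 X 2 …`).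
-/

noncomputable section

open CategoryTheory

namespace Literature.AlgebraicGeometry.Hyperkaehler

open Literature.AlgebraicTopology.SingularHomology
open Literature.AlgebraicGeometry.HodgeTheory

/-! ### The two existence facts -/

section Facts

/-- **Beauville 1983 (Prop. 8, Thm. 5) · Rapagnetta 2008 (table row `Kⁿ(T)`, Thm. 3.0.9) · O'Grady 2021
§2.2 · Huybrechts 1999 §1.9–1.11: every smooth projective variety `Y` of `Kumⁿ`-type, `n ≥ 2`, admits a
Beauville–Bogomolov marking, and its period point satisfies the Hodge clauses.**  There are
`φ : H²(Y(ℂ); ℂ) ≅ Λ_n ⊗ ℂ`, `Λ_n = U³ ⊕ ⟨−2(n+1)⟩` (`kumGram n`), an integral generator `P` of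
`H^{4n}(Y(ℂ); ℂ)` and `z ∈ Λ_n ⊗ ℂ` with: `IsMarkedKum n Y φ P` ("`(H²(Y,ℤ), B_Y) = H^{⊕3} ⊕ (−2(n+1))`",
"`∫α^{2n} = (n+1)(2n−1)!!(α,α)ⁿ`", `B_Y` deformation invariant, `c_Y` topological invariant); (m4) `φ⁻¹ z`
is of Hodge type `(2,0)` and every `(2,0)`-class is a multiple of it (`h^{2,0} = 1`); (m5) a class is of
type `(1,1)` iff it is `q`-orthogonal to `z` and to `z̄ = star z` ("`H^{1,1}` is orthogonal to
`H^{2,0} ⊕ H^{0,2}`", equality by the dimension count of the module docstring); (m6) `q(z,z) = 0` and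
`Re q(z̄, z) > 0` ("`q(σ) = 0`, `q(σ + σ̄) > 0`"), `q = kumForm n`.  GRADE: REFEREED (clause (m5)'s
"iff": PRINT-SYNTHESIS, one line).  -- TODO(general form): non-projective hyperkähler manifolds of
Kummer type (print: every irreducible symplectic `Y` deformation equivalent to `Kⁿ(T)`).
[cite: Rapagnetta2007, Introduction (p0003:L21–L31) and table row Kⁿ(T) (p0003:L48–L49); Thm. 3.0.9 (p0010:L9–L22)]
[cite: Beauville1983, §7 Prop. 8 (p0015:L42–L45); §8 Thm. 5 (a)–(b) (p0018:L35–L41)]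
[cite: OGrady2021KummerTori, §2.2 (arXiv:1805.12075 p0005:L121–L145)]
[cite: Huybrechts1999, §1.9 (p0004:L120–p0005:L8, p0005:L33–L38) and §1.11 (p0005:L80–L88)]
[cite: Markman2023GeneralizedKummers, §1.1 p. 234] [cite: HatcherAT2002, Thm. 3.26] -/
def Rapagnetta2008_exists_isMarkedKum : Prop :=
  ∀ (n : ℕ), 2 ≤ n → ∀ (Y : Motives.SchemeOver ℂ), Motives.IsSmoothProjective (2 * n) Y →
    IsOfGeneralizedKummerType n Y →
      ∃ (φ : complexBetti Y 2 ≃ₗ[ℂ] (KumIndex → ℂ)) (P : complexBetti Y (2 * (2 * n)))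
        (z : KumIndex → ℂ),
        IsMarkedKum n Y φ P ∧
          (IsOfHodgeType (2 * n) Y 2 2 0 (φ.symm z) ∧
            ∀ τ : complexBetti Y 2, IsOfHodgeType (2 * n) Y 2 2 0 τ → ∃ t : ℂ, τ = t • φ.symm z) ∧
          (∀ c : complexBetti Y 2, IsOfHodgeType (2 * n) Y 2 1 1 c ↔
            (kumForm n (φ c) z = 0 ∧ kumForm n (φ c) (star z) = 0)) ∧
          (kumForm n z z = 0 ∧ 0 < (kumForm n (star z) z).re)

/-- **Beauville 1983 (Prop. 6 with Remarque, Thm. 5, §9 Lemme 1 and Remarque 1) · Rapagnetta 2008 (table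
row `X^{[n]}`, Thm. 3.0.9) · Huybrechts 1999 §1.9–1.11: every smooth projective variety `X` of
`K3^{[n]}`-type, `n ≥ 2`, admits a Beauville–Bogomolov marking, and its period point satisfies the Hodge
clauses.**  There are `φ : H²(X(ℂ); ℂ) ≅ Λ_n ⊗ ℂ`, `Λ_n = Λ_{K3} ⊕ ⟨2−2n⟩` (`k3HilbertGram n`;
"`H²(S^{[r]},ℤ) = i(H²(S,ℤ)) ⊕ ℤδ`", "`q(i(α)) = α²`", "`q(e) = −8(r−1)`", `e = 2δ`; Rapagnetta:
"`H^{⊕3} ⊕ (−E₈)^{⊕2} ⊕ (−2(n−1))`"), an integral generator `P` of `H^{4n}(X(ℂ); ℂ)` and `z ∈ Λ_n ⊗ ℂ` with: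
`IsMarkedK3Hilb n X φ P` (Fujiki constant "`c_Y = (2n)!/(n!2ⁿ)`" `= (2n−1)!!`, deformation/topological
invariants); (m4) `φ⁻¹ z` is of type `(2,0)` and spans the `(2,0)`-classes ("`h^{2,0}(S^{[r]}) =
h^{2,0}(S) = 1`"); (m5) `(1,1)`-classes = classes `q`-orthogonal to `z` and `star z`; (m6) `q(z,z) = 0`,
`Re q(z̄,z) > 0`; `q = k3HilbertForm n`.  For `n = 2` these are (m1)–(m6) of the routes' `MarkedK3Sq`
(`exists_markedK3Sq` below gives the literal spelling).  GRADE: REFEREED ((m5)'s "iff": PRINT-SYNTHESIS,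
one line).  -- TODO(general form): non-projective manifolds of `K3^{[n]}`-type.
[cite: Rapagnetta2007, Introduction (p0003:L21–L31) and table row X^[n] (p0003:L46); Thm. 3.0.9 (p0010:L9–L22)]
[cite: Beauville1983, §6 Prop. 6 and Remarque (p0014:L23–L37); §8 Thm. 5 (p0018:L35–L41); §9 Lemme 1 (p0023:L22–L25) and Remarque 1 (p0024:L16–L19)]
[cite: Huybrechts1999, §1.9 (p0004:L120–p0005:L8, p0005:L33–L38) and §1.11 (p0005:L80–L88)]
[cite: Markman2024, §1.3 Step 1] [cite: HatcherAT2002, Thm. 3.26] -/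
def Rapagnetta2008_exists_isMarkedK3Hilb : Prop :=
  ∀ (n : ℕ), 2 ≤ n → ∀ (X : Motives.SchemeOver ℂ), Motives.IsSmoothProjective (2 * n) X →
    IsOfK3HilbertType n X →
      ∃ (φ : complexBetti X 2 ≃ₗ[ℂ] (K3HilbertIndex → ℂ)) (P : complexBetti X (2 * (2 * n)))
        (z : K3HilbertIndex → ℂ),
        IsMarkedK3Hilb n X φ P ∧
          (IsOfHodgeType (2 * n) X 2 2 0 (φ.symm z) ∧
            ∀ τ : complexBetti X 2, IsOfHodgeType (2 * n) X 2 2 0 τ → ∃ t : ℂ, τ = t • φ.symm z) ∧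
          (∀ c : complexBetti X 2, IsOfHodgeType (2 * n) X 2 1 1 c ↔
            (k3HilbertForm n (φ c) z = 0 ∧ k3HilbertForm n (φ c) (star z) = 0)) ∧
          (k3HilbertForm n z z = 0 ∧ 0 < (k3HilbertForm n (star z) z).re)

end Facts

/-! ### Kernel: Betti numbers `b₂ = 7` and `b₂ = 23` from a marking -/

section Betti

variable {Y : Motives.SchemeOver ℂ}

/-- A marking `H²(Y(ℂ); ℂ) ≅ Λ_n ⊗ ℂ = ℂ⁷` gives `b₂(Y) = 7` (Beauville Prop. 8: `b₂(K_r) = b₂(A) + 1 = 7`).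
[cite: Beauville1983, §7 Prop. 8] [cite: Rapagnetta2007, Introduction (table: b₂(Kⁿ(T)) = 7)] -/
theorem finrank_complexBetti_two_eq_seven_of_marking (φ : complexBetti Y 2 ≃ₗ[ℂ] (KumIndex → ℂ)) :
    Module.finrank ℂ (complexBetti Y 2) = 7 := by
  rw [φ.finrank_eq, Module.finrank_fintype_fun_eq_card, card_kumIndex]

/-- A marking `H²(X(ℂ); ℂ) ≅ Λ_n ⊗ ℂ = ℂ²³` gives `b₂(X) = 23` (Beauville Prop. 6: `b₂(S^{[r]}) = b₂(S) + 1
= 23`). [cite: Beauville1983, §6 Prop. 6] [cite: Rapagnetta2007, Introduction (table: b₂(X^[n]) = 23)] -/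
theorem finrank_complexBetti_two_eq_twentyThree_of_marking
    (φ : complexBetti Y 2 ≃ₗ[ℂ] (K3HilbertIndex → ℂ)) :
    Module.finrank ℂ (complexBetti Y 2) = 23 := by
  rw [φ.finrank_eq, Module.finrank_fintype_fun_eq_card]
  simp [K3HilbertIndex, Fintype.card_sum, Surfaces.K3Index]

end Betti

/-! ### Kernel: what the existence facts make unconditional, by name -/

namespace Rapagnetta2008_exists_isMarkedKum

/-- **`b₂(Y) = 7` for every smooth projective `Kumⁿ`-type `Y`, `n ≥ 2`** (Beauville Prop. 8; the value the
ladder's "sixfold host" reading `…sixfold_host` of `ThirdCohomologyKugaSatake` asks about).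
[cite: Beauville1983, §7 Prop. 8] [cite: Rapagnetta2007, Introduction (table)] -/
theorem finrank_complexBetti_two (h : Rapagnetta2008_exists_isMarkedKum) {n : ℕ} (hn : 2 ≤ n)
    {Y : Motives.SchemeOver ℂ} (hY : Motives.IsSmoothProjective (2 * n) Y)
    (hK : IsOfGeneralizedKummerType n Y) : Module.finrank ℂ (complexBetti Y 2) = 7 := by
  obtain ⟨φ, -, -, -, -⟩ := h n hn Y hY hK
  exact finrank_complexBetti_two_eq_seven_of_marking φ

/-- **Markman's `Mon²(Y) = 𝒲^{det·χ}` REALISED on every smooth projective `Kumⁿ`-type `Y`** (`n ≥ 2`):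
the marked record `Markman2023_monodromyGroupH2_kummerType` fed with a marking from this fact — both
inclusions, through SOME Beauville–Bogomolov marking `φ`. [cite: Markman2023GeneralizedKummers, Thm. 1.4 (p. 234)]
[cite: Rapagnetta2007, Introduction (table row Kⁿ(T))] -/
theorem exists_marking_monodromy (h : Rapagnetta2008_exists_isMarkedKum)
    (hM : Markman2023_monodromyGroupH2_kummerType) {n : ℕ} (hn : 2 ≤ n) {Y : Motives.SchemeOver ℂ}
    (hY : Motives.IsSmoothProjective (2 * n) Y) (hK : IsOfGeneralizedKummerType n Y) :
    ∃ (φ : complexBetti Y 2 ≃ₗ[ℂ] (KumIndex → ℂ)) (P : complexBetti Y (2 * (2 * n))),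
      IsMarkedKum n Y φ P ∧
        (∀ g ∈ monodromyGroup (2 * n) 2 Y, ∃ M ∈ detChiKer (kumGram n),
            ∀ x : complexBetti Y 2, φ (g x) = complexExtend M.toLinearMap (φ x)) ∧
        (∀ M ∈ detChiKer (kumGram n), ∃ g ∈ monodromyGroup (2 * n) 2 Y,
            ∀ x : complexBetti Y 2, φ (g x) = complexExtend M.toLinearMap (φ x)) := by
  obtain ⟨φ, P, -, hm, -, -, -⟩ := h n hn Y hY hK
  exact ⟨φ, P, hm, hM n hn Y hY hK φ P hm⟩

end Rapagnetta2008_exists_isMarkedKum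

namespace Rapagnetta2008_exists_isMarkedK3Hilb

/-- **`b₂(X) = 23` for every smooth projective `K3^{[n]}`-type `X`, `n ≥ 2`** (Beauville Prop. 6).
[cite: Beauville1983, §6 Prop. 6] [cite: Rapagnetta2007, Introduction (table)] -/
theorem finrank_complexBetti_two (h : Rapagnetta2008_exists_isMarkedK3Hilb) {n : ℕ} (hn : 2 ≤ n)
    {X : Motives.SchemeOver ℂ} (hX : Motives.IsSmoothProjective (2 * n) X) (hK : IsOfK3HilbertType n X) :
    Module.finrank ℂ (complexBetti X 2) = 23 := by
  obtain ⟨φ, -, -, -, -⟩ := h n hn X hX hK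
  exact finrank_complexBetti_two_eq_twentyThree_of_marking φ

/-- **O'Grady's dual Beauville–Bogomolov class is ALGEBRAIC on EVERY smooth projective fourfold of
`K3^{[2]}`-type** — the marked record `OGrady2008_dualBBFClass_algebraic` ("`c₂(X) = 6q^∨/5`", `q^∨`
algebraic, `(2/5)q^∨` integral) made unconditional in its marking: there IS a marking `φ`, and for it
`dualBBFClass 2 φ ∈ algebraicClasses X 2`. [cite: OGrady2008NumericalK3Square, §3 (proof of Prop. 3.2 (6), Claim 3.1)]
[cite: Rapagnetta2007, Introduction (table row X^[n])] -/
theorem exists_marking_dualBBFClass_algebraic (h : Rapagnetta2008_exists_isMarkedK3Hilb)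
    (hO : OGrady2008_dualBBFClass_algebraic) {X : Motives.SchemeOver ℂ}
    (hX : Motives.IsSmoothProjective 4 X) (hK : IsOfK3HilbertSquareType X) :
    ∃ (φ : complexBetti X 2 ≃ₗ[ℂ] (K3HilbertIndex → ℂ)) (P : complexBetti X (2 * (2 * 2))),
      IsMarkedK3Hilb 2 X φ P ∧ dualBBFClass 2 φ ∈ algebraicClasses X 2 ∧
        IsIntegralClass (((2 : ℂ) / 5) • dualBBFClass 2 φ) := by
  obtain ⟨φ, P, -, hm, -, -, -⟩ := h 2 le_rfl X hX hK
  exact ⟨φ, P, hm, hO X hX hK φ P hm⟩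

/-- **The `K3^{[2]}` existence statement in the literal `MarkedK3Sq[X, φ, P, z]` spelling of the routes
`NikulinTwinTransport` / `MarkmanPartnerTransport`** (clauses (m1)–(m6) with `cupPowTwo a 4`,
constant `3 = (2·2−1)!!`, `IsOfHodgeType 4 X 2 …`): every smooth projective fourfold of `K3^{[2]}`-type
carries such a marked period datum. [cite: Beauville1983, §6 Prop. 6, §8 Thm. 5, §9 Remarque 1]
[cite: Rapagnetta2007, Thm. 3.0.9 and table] [cite: Huybrechts1999, §1.9] -/
theorem exists_markedK3Sq (h : Rapagnetta2008_exists_isMarkedK3Hilb) {X : Motives.SchemeOver ℂ}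
    (hX : Motives.IsSmoothProjective 4 X) (hK : IsOfK3HilbertSquareType X) :
    ∃ (φ : complexBetti X 2 ≃ₗ[ℂ] (K3HilbertIndex → ℂ)) (P : complexBetti X (2 * 4))
      (z : K3HilbertIndex → ℂ),
      ((IsIntegralClass P ∧ ∀ Q : complexBetti X (2 * 4), IsIntegralClass Q → ∃ n : ℤ, Q = n • P) ∧
        (∀ c : complexBetti X 2, IsIntegralClass c ↔ ∃ v : K3HilbertIndex → ℤ, φ c = fun i => (v i : ℂ)) ∧
        (∀ a : complexBetti X 2, cupPowTwo a 4 = ((3 : ℂ) * (k3HilbertForm 2 (φ a) (φ a)) ^ 2) • P) ∧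
        (IsOfHodgeType 4 X 2 2 0 (LinearEquiv.symm φ z) ∧
          ∀ τ : complexBetti X 2, IsOfHodgeType 4 X 2 2 0 τ → ∃ t : ℂ, τ = t • LinearEquiv.symm φ z) ∧
        (∀ c : complexBetti X 2, IsOfHodgeType 4 X 2 1 1 c ↔
            (k3HilbertForm 2 (φ c) z = 0 ∧ k3HilbertForm 2 (φ c) (star z) = 0)) ∧
        (k3HilbertForm 2 z z = 0 ∧ 0 < (k3HilbertForm 2 (star z) z).re)) := by
  obtain ⟨φ, P, z, ⟨hP, hint, hfuj⟩, h20, h11, hz⟩ := h 2 le_rfl X hX hK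
  refine ⟨φ, P, z, hP, hint, fun a ↦ ?_, h20, h11, hz⟩
  rw [hfuj a, doubleFactorial_K3HilbertSquare]
  norm_num

end Rapagnetta2008_exists_isMarkedK3Hilb

end Literature.AlgebraicGeometry.Hyperkaehler

end
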